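import Literature.Analysis.FunctionSpaces.SquaredBesselProofs
import Literature.Analysis.FunctionSpaces.SquaredBesselExistence
import HarnessLib

/-!
# Squared Bessel processes: moments and nonnegativity

Topic `Analysis/FunctionSpaces`; sibling proof file of `ItoProcesses.lean`, `SquaredBessel.lean`,
`SquaredBesselExistence.lean` (existence of `BESQ^δ(z₀)` as the limit of the Euler–Maruyama scheme)
and `SquaredBesselUniqueness.lean` (pathwise uniqueness). On the canonical space
`(ℝ≥0 → ℝ, preWienerMeasure)` with the canonical Brownian motion `B = brownian` and its raw
filtration `𝓕 = brownianFiltration`, for a squared Bessel process `Z`, i.e. a solution adapted to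
`𝓕` of `dZ = δ dt + 2√|Z| dB`, `Z₀ = z₀` (`IsSquaredBesselProcess`, Revuz–Yor Ch. XI Def. (1.1)):

* `IsSquaredBesselProcess.exists_martingale_repr` — **`Z_t = z₀ + δ t + J_t` with `J` a
  square-integrable martingale** (for the raw filtration), almost surely for all `t`: the
  Euler–Maruyama solution of `SquaredBesselExistence` has this form
  (`exists_isSquaredBesselProcess_martingale`), and any solution is indistinguishable from it
  (`pathwiseUnique_squaredBessel_holds`). Consequences: `Z_t ∈ L¹`, `E Z_t = z₀ + δ t`
  (Revuz–Yor Ch. XI, Exercise (1.33)-type moment identity, here simply `E ∫ 2√|Z| dB = 0`), and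
  `E ∫₀ᵗ |Z_s| ds < ∞` for a progressive solution.
* `IsSquaredBesselProcess.ae_nonneg` — **nonnegativity**: for `δ ≥ 0`, `z₀ ≥ 0`, almost surely
  `Z_t ≥ 0` for all `t` (Revuz–Yor, Ch. XI, §1, p. 439: the solution of `dZ = δ dt + 2√|Z| dB`
  with `δ ≥ 0`, `x ≥ 0` is `≥ 0` by the comparison theorem Ch. IX (3.7), comparing with the zero
  solution for `δ = x = 0`). The tree has no comparison theorem and no local times; the proof
  given here is the expectation argument of Yamada–Watanabe run one-sidedly: for the even `C²`
  test functions `Φ = ywFun p` of `YamadaWatanabeOccupation.lean` (`|Φ'| ≤ 1`,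
  `|x| - η ≤ Φ(x) ≤ |x|`, `Φ'' = p ∘ |·|`), Itô's formula (`ito_formula_itoProcess_ae_holds`) with
  the martingale Itô integral `∫ 2√|Z| Φ'(Z) dB` (`exists_isItoIntegral_of_sq_integrable`) gives
  `E|Z_t| - η ≤ E Φ(Z_t) ≤ z₀ + δ t + ½ E ∫₀ᵗ 4|Z| p(|Z|) ds`, and the last term is `½ ∫ p dν`
  for the occupation measure `ν` of `|Z|` weighted by `d⟨Z⟩ = 4|Z| ds`, which satisfies
  `∫ (4a)⁻¹ dν ≤ t`; choosing `p` adapted to `ν` (`exists_testDensity`) makes it `≤ η`, so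
  `E|Z_t| ≤ E Z_t = z₀ + δ t`, i.e. `E Z_t⁻ = 0`.

## References

* D. Revuz, M. Yor, *Continuous Martingales and Brownian Motion* (3rd ed., 1999), Ch. XI, §1
  (p. 439, Def. (1.1)); Ch. IX, Thm (3.5)(ii), Thm (3.7); Ch. IV, Thm (3.3).
* T. Yamada, S. Watanabe, *On the uniqueness of solutions of stochastic differential
  equations*, J. Math. Kyoto Univ. 11 (1971), 155–167, Thm 1.
-/

noncomputable section

open MeasureTheory Filter Set
open scoped NNReal ENNReal Topology

namespace Literature.Analysis.FunctionSpaces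

open Literature.Probability.Process Literature.Probability.RandomPlanarGeometry

/-! ### The martingale representation `Z = z₀ + δ t + J` -/

/-- **The Euler–Maruyama squared Bessel process and its martingale part.** For all real `δ, z₀`
there is a squared Bessel process `Z = BESQ^δ(z₀)` driven by the canonical Brownian motion of the
form `Z_t = z₀ + δ t + J_t` for *all* `(t, ω)`, where `J` (the limit of the martingale parts of
the Euler scheme, `exists_limit_eulerM`, `martingale_limit_eulerM`) is a square-integrable
martingale for the raw Brownian filtration, jointly measurable, with `J_0 = 0`. This is the
solution of `exists_isSquaredBesselProcess` with the extra information its construction carries.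
Revuz–Yor, *Continuous Martingales and Brownian Motion* (1999), Ch. XI, §1 (p. 439) and
Def. (1.1); Ch. IV, Thm (2.2). [folklore] -/
theorem exists_isSquaredBesselProcess_martingale (δ z₀ : ℝ) :
    ∃ Z J : ℝ≥0 → (ℝ≥0 → ℝ) → ℝ,
      IsSquaredBesselProcess δ z₀ Z brownian brownianFiltration preWienerMeasure ∧
      Martingale J brownianFiltration preWienerMeasure ∧
      (∀ t, MemLp (J t) 2 preWienerMeasure) ∧ Measurable (Function.uncurry J) ∧
      (∀ ω, J 0 ω = 0) ∧ ∀ t ω, Z t ω = z₀ + δ * (t : ℝ) + J t ω := by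
  haveI := isProbabilityMeasure_preWienerMeasure'
  obtain ⟨J, hJa, hJc, hJ0, hJucp, hJm, φ, hφ, hJφ⟩ := exists_limit_eulerM δ z₀
  obtain ⟨hJL2, -, hmart⟩ := martingale_limit_eulerM hJa hφ hJφ
  have hL2 : ∀ (T : ℝ≥0) (κ : ℝ), 0 < κ → ∃ N, ∀ n ≥ N, ∀ t ≤ T,
      ∫⁻ ω, ENNReal.ofReal ((eulerM δ z₀ n t ω - J t ω) ^ 2) ∂preWienerMeasure ≤
        ENNReal.ofReal κ :=
    fun T κ hκ ↦ exists_forall_lintegral_eulerM_sub_sq_le hφ hJφ T hκ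
  set Z := eulerLimitZ δ z₀ J with hZ
  have hZm : Measurable (Function.uncurry Z) := measurable_uncurry_eulerLimitZ δ z₀ hJm
  have happrox := isApproxSeq_eulerSP δ z₀ hJm hL2
  have hσ' : ∀ᵐ ω ∂preWienerMeasure, Measurable fun s : ℝ ↦ besqσ (Z s.toNNReal ω) :=
    ae_of_all _ fun ω ↦ continuous_besqσ.measurable.comp (measurable_section_toNNReal hZm ω)
  have hIto : IsItoIntegral (fun s ω ↦ besqσ (Z s ω)) brownian J brownianFiltration
      preWienerMeasure :=
    ⟨hJ0, hJc, hmart.isLocalMartingale, ⟨fun n ↦ eulerSP δ z₀ n, happrox⟩,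
      fun Hn hHn ↦ tendstoUCP_of_isApproxSeq_brownian hσ' happrox hHn hJucp⟩
  refine ⟨Z, J, ⟨fun ω ↦ ?_, fun t ↦ ?_, ⟨ae_of_all _ fun ω t ↦ ?_, J, hIto,
    ae_of_all _ fun ω t ↦ ?_⟩⟩, hmart, hJL2, hJm, hJ0, fun t ω ↦ eulerLimitZ_eq δ z₀ J t ω⟩
  · simp [hZ, eulerLimitZ, hJ0 ω]
  · exact (measurable_const.add (hJa t).measurable :
      Measurable[brownianFiltration t] fun ω ↦ (z₀ + ∫ _ in (0 : ℝ)..t, δ) + J t ω)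
  · exact integrableOn_const (measure_Icc_lt_top (a := (0 : ℝ)) (b := (t : ℝ))).ne
  · have h0 : Z 0 ω = z₀ := by simp [hZ, eulerLimitZ, hJ0 ω]
    rw [h0]
    rfl

namespace IsSquaredBesselProcess

variable {δ z₀ : ℝ} {Z : ℝ≥0 → (ℝ≥0 → ℝ) → ℝ}

/-- **Martingale representation of a squared Bessel process.** Every squared Bessel process
`Z = BESQ^δ(z₀)` driven by the canonical Brownian motion (raw filtration) satisfies, almost
surely for all `t`, `Z_t = z₀ + δ t + J_t` for a square-integrable, jointly measurable martingale
`J` with `J_0 = 0` (the martingale part of the Euler–Maruyama solution, from which `Z` is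
indistinguishable by pathwise uniqueness `pathwiseUnique_squaredBessel_holds`).
Revuz–Yor, *Continuous Martingales and Brownian Motion* (1999), Ch. XI, §1, p. 439 ("for every
`δ` and `x`, this equation has a unique strong solution"). [folklore] -/
theorem exists_martingale_repr
    (hZ : IsSquaredBesselProcess δ z₀ Z brownian brownianFiltration preWienerMeasure) :
    ∃ J : ℝ≥0 → (ℝ≥0 → ℝ) → ℝ, Martingale J brownianFiltration preWienerMeasure ∧
      (∀ t, MemLp (J t) 2 preWienerMeasure) ∧ Measurable (Function.uncurry J) ∧
      (∀ ω, J 0 ω = 0) ∧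
      ∀ᵐ ω ∂preWienerMeasure, ∀ t, Z t ω = z₀ + δ * (t : ℝ) + J t ω := by
  obtain ⟨Z', J, hZ', hM, hL2, hJm, hJ0, heq⟩ := exists_isSquaredBesselProcess_martingale δ z₀
  refine ⟨J, hM, hL2, hJm, hJ0, ?_⟩
  filter_upwards [pathwiseUnique_squaredBessel_holds hZ hZ'] with ω hω t
  rw [hω t, heq t ω]

/-- The marginals of a squared Bessel process driven by the canonical Brownian motion are
measurable (the process is adapted to the raw Brownian filtration). [folklore] -/
theorem measurable_apply
    (hZ : IsSquaredBesselProcess δ z₀ Z brownian brownianFiltration preWienerMeasure) (t : ℝ≥0) :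
    Measurable (Z t) :=
  (IsStrongSolution.adapted hZ t).mono (brownianFiltration.le t) le_rfl

/-- **`Z_t ∈ L¹`** for a squared Bessel process driven by the canonical Brownian motion
(`Z_t = z₀ + δ t + J_t` a.s. with `J_t ∈ L²`).
Revuz–Yor, *Continuous Martingales and Brownian Motion* (1999), Ch. XI, §1. [folklore] -/
theorem integrable
    (hZ : IsSquaredBesselProcess δ z₀ Z brownian brownianFiltration preWienerMeasure) (t : ℝ≥0) :
    Integrable (Z t) preWienerMeasure := by
  haveI := isProbabilityMeasure_preWienerMeasure'
  obtain ⟨J, hM, -, -, -, heq⟩ := hZ.exists_martingale_repr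
  have h1 : Integrable (fun ω ↦ z₀ + δ * (t : ℝ) + J t ω) preWienerMeasure :=
    (integrable_const _).add (hM.integrable t)
  refine h1.congr ?_
  filter_upwards [heq] with ω hω
  exact (hω t).symm

/-- **`E Z_t = z₀ + δ t`** for a squared Bessel process driven by the canonical Brownian motion
(the martingale part has expectation `E J_t = E J_0 = 0`).
Revuz–Yor, *Continuous Martingales and Brownian Motion* (1999), Ch. XI, §1 (cf. Ex. (1.33):
the moments of `BESQ`). [folklore] -/
theorem integral_eq
    (hZ : IsSquaredBesselProcess δ z₀ Z brownian brownianFiltration preWienerMeasure) (t : ℝ≥0) :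
    ∫ ω, Z t ω ∂preWienerMeasure = z₀ + δ * (t : ℝ) := by
  haveI := isProbabilityMeasure_preWienerMeasure'
  obtain ⟨J, hM, -, -, hJ0, heq⟩ := hZ.exists_martingale_repr
  have hEJ : ∫ ω, J t ω ∂preWienerMeasure = 0 := by
    have h := hM.setIntegral_eq (show (0 : ℝ≥0) ≤ t from bot_le)
      (MeasurableSet.univ (α := ℝ≥0 → ℝ))
    rw [setIntegral_univ, setIntegral_univ] at h
    rw [← h]
    simp [hJ0]
  calc ∫ ω, Z t ω ∂preWienerMeasure = ∫ ω, (z₀ + δ * (t : ℝ) + J t ω) ∂preWienerMeasure :=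
        integral_congr_ae (heq.mono fun ω hω ↦ hω t)
    _ = z₀ + δ * (t : ℝ) := by
        rw [integral_add (integrable_const _) (hM.integrable t), integral_const, hEJ]
        simp

/-- **`E ∫₀ᵗ |Z_s| ds < ∞`** for a squared Bessel process driven by the canonical Brownian motion
(as an iterated lower integral; no path measurability is needed): `Z = z₀ + δ s + J` a.s. with
`E|J_s| ≤ E|J_t|` for `s ≤ t` (conditional Jensen, `J` a martingale), and Tonelli.
Revuz–Yor, *Continuous Martingales and Brownian Motion* (1999), Ch. XI, §1. [folklore] -/
theorem lintegral_abs_ne_top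
    (hZ : IsSquaredBesselProcess δ z₀ Z brownian brownianFiltration preWienerMeasure) (t : ℝ≥0) :
    ∫⁻ ω, (∫⁻ s in Set.Icc (0 : ℝ) t, ENNReal.ofReal |Z s.toNNReal ω|) ∂preWienerMeasure ≠ ∞ := by
  haveI := isProbabilityMeasure_preWienerMeasure'
  obtain ⟨J, hM, -, hJm, -, heq⟩ := hZ.exists_martingale_repr
  -- the representation `R = z₀ + δ s + J`
  set R : ℝ≥0 → (ℝ≥0 → ℝ) → ℝ := fun s ω ↦ z₀ + δ * (s : ℝ) + J s ω with hR
  have hRm : Measurable fun p : (ℝ≥0 → ℝ) × ℝ ↦ R p.2.toNNReal p.1 := by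
    have hJ2 : Measurable fun p : (ℝ≥0 → ℝ) × ℝ ↦ J p.2.toNNReal p.1 :=
      hJm.comp ((measurable_real_toNNReal.comp measurable_snd).prodMk measurable_fst)
    exact ((measurable_const.add (measurable_const.mul ((measurable_coe_nnreal_real.comp
      measurable_real_toNNReal).comp measurable_snd))).add hJ2)
  have hcongr : ∫⁻ ω, (∫⁻ s in Set.Icc (0 : ℝ) t, ENNReal.ofReal |Z s.toNNReal ω|)
      ∂preWienerMeasure =
      ∫⁻ ω, (∫⁻ s in Set.Icc (0 : ℝ) t, ENNReal.ofReal |R s.toNNReal ω|) ∂preWienerMeasure := by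
    refine lintegral_congr_ae (heq.mono fun ω hω ↦ ?_)
    exact lintegral_congr fun s ↦ by rw [hω]
  rw [hcongr, lintegral_lintegral_swap
    ((continuous_abs.measurable.comp hRm).ennreal_ofReal).aemeasurable]
  -- the bound `E|R_s| ≤ |z₀| + |δ| t + E|J_t|` for `s ≤ t`
  have hJs : ∀ s : ℝ≥0, s ≤ t →
      ∫⁻ ω, ‖J s ω‖ₑ ∂preWienerMeasure ≤ eLpNorm (J t) 1 preWienerMeasure := by
    intro s hs
    rw [← eLpNorm_one_eq_lintegral_enorm, ← eLpNorm_congr_ae (hM.condExp_ae_eq hs)]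
    exact eLpNorm_condExp_le_eLpNorm _ le_rfl
  set C : ℝ≥0∞ := ENNReal.ofReal (|z₀| + |δ| * (t : ℝ)) + eLpNorm (J t) 1 preWienerMeasure
    with hC
  have hCfin : C ≠ ∞ := ENNReal.add_ne_top.2 ⟨ENNReal.ofReal_ne_top,
    (memLp_one_iff_integrable.2 (hM.integrable t)).eLpNorm_ne_top⟩
  have hbound : ∀ s ∈ Set.Icc (0 : ℝ) t,
      ∫⁻ ω, ENNReal.ofReal |R s.toNNReal ω| ∂preWienerMeasure ≤ C := by
    intro s hs
    have hst : s.toNNReal ≤ t := Real.toNNReal_le_iff_le_coe.2 hs.2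
    have hs' : ((s.toNNReal : ℝ≥0) : ℝ) ≤ t := NNReal.coe_le_coe.2 hst
    calc ∫⁻ ω, ENNReal.ofReal |R s.toNNReal ω| ∂preWienerMeasure
        ≤ ∫⁻ ω, (ENNReal.ofReal (|z₀| + |δ| * (t : ℝ)) + ‖J s.toNNReal ω‖ₑ)
            ∂preWienerMeasure := by
          refine lintegral_mono fun ω ↦ ?_
          rw [Real.enorm_eq_ofReal_abs, ← ENNReal.ofReal_add (by positivity) (abs_nonneg _)]
          refine ENNReal.ofReal_le_ofReal ?_
          calc |R s.toNNReal ω| = |z₀ + δ * ((s.toNNReal : ℝ≥0) : ℝ) + J s.toNNReal ω| := rfl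
            _ ≤ |z₀| + |δ * ((s.toNNReal : ℝ≥0) : ℝ)| + |J s.toNNReal ω| := abs_add_three _ _ _
            _ ≤ |z₀| + |δ| * (t : ℝ) + |J s.toNNReal ω| := by
                rw [abs_mul, abs_of_nonneg (NNReal.coe_nonneg _)]
                gcongr
      _ = ENNReal.ofReal (|z₀| + |δ| * (t : ℝ)) + ∫⁻ ω, ‖J s.toNNReal ω‖ₑ ∂preWienerMeasure := by
          rw [lintegral_add_left measurable_const, lintegral_const, measure_univ, mul_one]
      _ ≤ C := add_le_add le_rfl (hJs _ hst)
  refine ne_top_of_le_ne_top (ENNReal.mul_ne_top hCfin (measure_Icc_lt_top (μ := volume)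
    (a := (0 : ℝ)) (b := (t : ℝ))).ne) ?_
  calc ∫⁻ s in Set.Icc (0 : ℝ) t, ∫⁻ ω, ENNReal.ofReal |R s.toNNReal ω| ∂preWienerMeasure
      ≤ ∫⁻ _ in Set.Icc (0 : ℝ) t, C := setLIntegral_mono measurable_const hbound
    _ = C * volume (Set.Icc (0 : ℝ) t) := setLIntegral_const _ _

/-! ### Nonnegativity of `BESQ^δ(z₀)` for `δ, z₀ ≥ 0` -/

/-- **The one-sided Yamada–Watanabe estimate `E|Z_t| ≤ z₀ + δ t`** for a progressively measurable
squared Bessel process `Z = BESQ^δ(z₀)` with `δ ≥ 0`, `z₀ ≥ 0`, driven by the canonical Brownian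
motion (raw filtration). For an even `C²` test function `Φ = ywFun p` (`|Φ'| ≤ 1`,
`|x| - η/2 ≤ Φ(x) ≤ |x|`, `Φ'' = p ∘ |·|`), Itô's formula with the martingale Itô integral
`∫ 2√|Z| Φ'(Z) dB` gives `E|Z_t| - η/2 ≤ E Φ(Z_t) ≤ Φ(z₀) + δ t + ½ E ∫₀ᵗ 4|Z_s| p(|Z_s|) ds`
(`δ Φ' ≤ δ`); the last expectation is `∫ p dν` for the occupation measure `ν` of `|Z|` on `[0, t]`
weighted by `4|Z| ds`, which has `∫ (4a)⁻¹ dν ≤ t`, so that `p` may be chosen with `∫ p dν ≤ η`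
(`exists_testDensity`). This replaces the comparison theorem (Revuz–Yor Ch. IX Thm (3.7), proved
there through local times) in the proof that `BESQ^δ(x) ≥ 0`.
Revuz–Yor, *Continuous Martingales and Brownian Motion* (1999), Ch. XI, §1, p. 439, with Ch. IX,
Thm (3.7) and Lemma (3.3); Yamada–Watanabe (1971), Thm 1. [cite: RevuzYor1999, Ch. XI §1 (p. 439) and Ch. IX Thm (3.7)] -/
theorem integral_abs_le_of_isStronglyProgressive
    (hZ : IsSquaredBesselProcess δ z₀ Z brownian brownianFiltration preWienerMeasure)
    (hprog : IsStronglyProgressive brownianFiltration Z) (hδ : 0 ≤ δ) (hz₀ : 0 ≤ z₀) (t : ℝ≥0) :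
    ∫ ω, |Z t ω| ∂preWienerMeasure ≤ z₀ + δ * (t : ℝ) := by
  haveI := isProbabilityMeasure_preWienerMeasure'
  have hZint := hZ.integrable
  have hZabs := hZ.lintegral_abs_ne_top
  have hZc := IsStrongSolution.ae_continuous hZ
  have hZtm : ∀ s, Measurable (Z s) := hZ.measurable_apply
  obtain ⟨hZ0, hZa, hint, J, hJ, heq⟩ := hZ
  -- the diffusion coefficient `σ' = 2√|Z|` and the Itô process structure
  set σ' : ℝ≥0 → (ℝ≥0 → ℝ) → ℝ := fun s ω ↦ 2 * Real.sqrt |Z s ω| with hσ'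
  have hX : IsItoProcess Z (fun _ _ ↦ δ) σ' brownian brownianFiltration preWienerMeasure :=
    ⟨hint, J, hJ, heq⟩
  have hσc : Continuous fun z : ℝ ↦ 2 * Real.sqrt |z| := by fun_prop
  have hσp : IsStronglyProgressive brownianFiltration σ' :=
    IsStronglyProgressive.continuous_comp hprog hσc
  have hσ'sq : ∀ s ω, σ' s ω ^ 2 = 4 * |Z s ω| := fun s ω ↦ by
    rw [hσ', mul_pow, Real.sq_sqrt (abs_nonneg _)]; norm_num
  -- joint measurability on `Ω × ℝ`
  have hZm := measurable_toNNReal_of_isStronglyProgressive hprog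
  have hσm := measurable_toNNReal_of_isStronglyProgressive hσp
  have habsZ_m : Measurable fun z : (ℝ≥0 → ℝ) × ℝ ↦ |Z z.2.toNNReal z.1| :=
    continuous_abs.measurable.comp hZm
  have hae_prod : ∀ {P : (ℝ≥0 → ℝ) → ℝ → Prop} (μt : Measure ℝ),
      (∀ᵐ ω ∂preWienerMeasure, ∀ s, P ω s) →
        ∀ᵐ z ∂(preWienerMeasure.prod μt), P z.1 z.2 :=
    fun μt h ↦ (Measure.quasiMeasurePreserving_fst.ae h).mono fun z hz ↦ hz z.2
  -- `E ∫₀ᵗ σ'² ds = 4 E ∫₀ᵗ |Z| ds < ∞`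
  have hγsq : ∀ t' : ℝ≥0, ∫⁻ ω, (∫⁻ s in Set.Icc (0 : ℝ) t',
      ENNReal.ofReal (σ' s.toNNReal ω ^ 2)) ∂preWienerMeasure ≠ ∞ := by
    intro t'
    have h4 : ∀ ω, ∫⁻ s in Set.Icc (0 : ℝ) t', ENNReal.ofReal (σ' s.toNNReal ω ^ 2) =
        ENNReal.ofReal 4 * ∫⁻ s in Set.Icc (0 : ℝ) t', ENNReal.ofReal |Z s.toNNReal ω| := by
      intro ω
      rw [← lintegral_const_mul' _ _ ENNReal.ofReal_ne_top]
      refine lintegral_congr fun s ↦ ?_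
      rw [hσ'sq, ENNReal.ofReal_mul (by norm_num)]
    simp_rw [h4]
    rw [lintegral_const_mul' _ _ ENNReal.ofReal_ne_top]
    exact ENNReal.mul_ne_top ENNReal.ofReal_ne_top (hZabs t')
  -- the weighted expected occupation measure `ν` of `|Z|` on `[0, t]`
  set πT : Measure ((ℝ≥0 → ℝ) × ℝ) :=
    preWienerMeasure.prod (volume.restrict (Set.Ioc (0 : ℝ) t)) with hπT
  haveI hvolT : IsFiniteMeasure (volume.restrict (Set.Ioc (0 : ℝ) t)) :=
    isFiniteMeasure_restrict.2 (by simp)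
  haveI : IsFiniteMeasure πT := by rw [hπT]; infer_instance
  set dens : (ℝ≥0 → ℝ) × ℝ → ℝ≥0 := fun z ↦ (σ' z.2.toNNReal z.1 ^ 2).toNNReal with hdens
  have hdens_m : Measurable dens := (hσm.pow_const 2).real_toNNReal
  have hdens_eq : ∀ z, (dens z : ℝ≥0∞) = ENNReal.ofReal (σ' z.2.toNNReal z.1 ^ 2) := fun z ↦ rfl
  set ν : Measure ℝ := (πT.withDensity fun z ↦ (dens z : ℝ≥0∞)).map
    fun z ↦ |Z z.2.toNNReal z.1| with hν
  have hγ2_lint : ∫⁻ z, (dens z : ℝ≥0∞) ∂πT ≠ ∞ := by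
    have h1 : ∫⁻ z, (dens z : ℝ≥0∞) ∂πT = ∫⁻ ω, (∫⁻ s in Set.Ioc (0 : ℝ) t,
        ENNReal.ofReal (σ' s.toNNReal ω ^ 2)) ∂preWienerMeasure := by
      rw [hπT, lintegral_prod _ hdens_m.coe_nnreal_ennreal.aemeasurable]
      exact lintegral_congr fun ω ↦ lintegral_congr fun s ↦ rfl
    rw [h1]
    exact ne_top_of_le_ne_top (hγsq t)
      (lintegral_mono fun ω ↦ lintegral_mono_set Set.Ioc_subset_Icc_self)
  have hγ2_int : Integrable (fun z : (ℝ≥0 → ℝ) × ℝ ↦ σ' z.2.toNNReal z.1 ^ 2) πT := by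
    refine ⟨(hσm.pow_const 2).aestronglyMeasurable, ?_⟩
    rw [hasFiniteIntegral_iff_ofReal (ae_of_all _ fun z ↦ sq_nonneg _)]
    exact lt_top_iff_ne_top.2 hγ2_lint
  haveI : IsFiniteMeasure ν := by
    refine ⟨?_⟩
    rw [hν, Measure.map_apply habsZ_m MeasurableSet.univ, Set.preimage_univ,
      withDensity_apply _ MeasurableSet.univ, Measure.restrict_univ]
    exact lt_top_iff_ne_top.2 hγ2_lint
  -- `∫_{(0,∞)} (4a)⁻¹ dν ≤ t < ∞`, since `σ'² = 4|Z|`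
  have hρm : Measurable fun a : ℝ ↦ 4 * a := measurable_const.mul measurable_id
  have hρpos : ∀ a : ℝ, 0 < a → 0 < 4 * a := fun a ha ↦ by positivity
  have hγρ' : ∀ ω (s : ℝ),
      ENNReal.ofReal (σ' s.toNNReal ω ^ 2) *
        (Set.Ioi (0 : ℝ)).indicator (fun a ↦ ENNReal.ofReal (4 * a)⁻¹) |Z s.toNNReal ω| ≤ 1 := by
    intro ω s
    by_cases hZ0' : Z s.toNNReal ω = 0
    · rw [hZ0', abs_zero, Set.indicator_of_notMem (fun h : (0 : ℝ) ∈ Set.Ioi 0 ↦ lt_irrefl _ h),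
        mul_zero]
      exact zero_le_one
    · have hpos : 0 < |Z s.toNNReal ω| := abs_pos.2 hZ0'
      rw [Set.indicator_of_mem (show |Z s.toNNReal ω| ∈ Set.Ioi 0 from hpos),
        ← ENNReal.ofReal_mul (sq_nonneg _), ← ENNReal.ofReal_one, hσ'sq]
      refine ENNReal.ofReal_le_ofReal (le_of_eq ?_)
      field_simp
  have hν_fin : ∫⁻ a in Set.Ioi 0, ENNReal.ofReal (4 * a)⁻¹ ∂ν ≠ ∞ := by
    have hmeas_ind : Measurable fun a : ℝ ↦
        (Set.Ioi (0 : ℝ)).indicator (fun a ↦ ENNReal.ofReal (4 * a)⁻¹) a :=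
      (hρm.inv.ennreal_ofReal).indicator measurableSet_Ioi
    have hg_m : Measurable fun z : (ℝ≥0 → ℝ) × ℝ ↦
        (Set.Ioi (0 : ℝ)).indicator (fun a ↦ ENNReal.ofReal (4 * a)⁻¹) |Z z.2.toNNReal z.1| :=
      hmeas_ind.comp habsZ_m
    rw [← lintegral_indicator measurableSet_Ioi, hν, lintegral_map hmeas_ind habsZ_m,
      lintegral_withDensity_eq_lintegral_mul _ hdens_m.coe_nnreal_ennreal hg_m]
    have hle : ∀ z, ((fun z ↦ (dens z : ℝ≥0∞)) * fun z : (ℝ≥0 → ℝ) × ℝ ↦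
        (Set.Ioi (0 : ℝ)).indicator (fun a ↦ ENNReal.ofReal (4 * a)⁻¹) |Z z.2.toNNReal z.1|) z ≤
          1 := by
      intro z
      simp only [Pi.mul_apply, hdens_eq]
      exact hγρ' z.1 z.2
    refine ne_top_of_le_ne_top ?_ (lintegral_mono hle)
    rw [lintegral_const, one_mul]
    exact measure_ne_top _ _
  -- the occupation formula `∫ φ dν = E ∫₀ᵗ σ'² φ(|Z|) ds` for bounded continuous `φ`
  have hoccup : ∀ {φ : ℝ → ℝ}, Continuous φ → (∃ C, ∀ x, ‖φ x‖ ≤ C) →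
      ∫ x, φ x ∂ν = ∫ ω, (∫ s in Set.Ioc (0 : ℝ) t,
        σ' s.toNNReal ω ^ 2 * φ |Z s.toNNReal ω|) ∂preWienerMeasure := by
    intro φ hφ hφbd
    obtain ⟨C, hC⟩ := hφbd
    have hsmul : (fun z : (ℝ≥0 → ℝ) × ℝ ↦ dens z • φ |Z z.2.toNNReal z.1|) =
        fun z ↦ σ' z.2.toNNReal z.1 ^ 2 * φ |Z z.2.toNNReal z.1| := by
      funext z
      rw [NNReal.smul_def, smul_eq_mul, hdens, Real.coe_toNNReal _ (sq_nonneg _)]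
    have hint : Integrable (fun z : (ℝ≥0 → ℝ) × ℝ ↦
        σ' z.2.toNNReal z.1 ^ 2 * φ |Z z.2.toNNReal z.1|) πT := by
      refine Integrable.mono' (hγ2_int.mul_const C)
        ((hσm.pow_const 2).mul (hφ.measurable.comp habsZ_m)).aestronglyMeasurable
        (ae_of_all _ fun z ↦ ?_)
      rw [norm_mul, Real.norm_eq_abs, abs_of_nonneg (sq_nonneg _)]
      exact mul_le_mul_of_nonneg_left (hC _) (sq_nonneg _)
    rw [hν, integral_map habsZ_m.aemeasurable hφ.aestronglyMeasurable,
      integral_withDensity_eq_integral_smul hdens_m, hsmul, hπT, integral_prod _ (hπT ▸ hint)]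
  -- **the estimate**, for every `η > 0`
  refine le_of_forall_pos_le_add fun η hη ↦ ?_
  have hη2 : 0 < η / 2 := half_pos hη
  obtain ⟨p, hpc, hpcs, hp0, hpsupp, hpint, -, hpε⟩ :=
    exists_testDensity hρm hρpos (fun ε hε ↦ not_integrableOn_inv_four_mul hε) ν hν_fin hη2 hη
  -- the test function `Φ = ywFun p`
  have hΦc2 : ContDiff ℝ 2 (ywFun p) := contDiff_ywFun hpc
  have hΦ'c : Continuous (deriv (ywFun p)) := by
    rw [deriv_ywFun hpc]; exact continuous_ywDeriv hpc
  have hΦ'bd : ∀ x, |deriv (ywFun p) x| ≤ 1 := fun x ↦ by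
    rw [deriv_ywFun hpc]; exact abs_ywDeriv_le_one hpc hp0 hpsupp hpint hη2 x
  have hΦlow : ∀ x, |x| - η / 2 ≤ ywFun p x := sub_le_ywFun hpc hp0 hpsupp hpint hη2
  have hΦabs : ∀ x, |ywFun p x| ≤ |x| := abs_ywFun_le_abs hpc hp0 hpsupp hpint hη2
  have hΦ'' : iteratedDeriv 2 (ywFun p) = fun x ↦ p |x| := iteratedDeriv_two_ywFun hpc
  obtain ⟨Cp, hCp⟩ := hpc.bounded_above_of_compact_support hpcs
  -- the martingale Itô integral `Kp = ∫ σ' Φ'(Z) dB`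
  have hgp : IsStronglyProgressive brownianFiltration
      fun s ω ↦ σ' s ω * deriv (ywFun p) (Z s ω) :=
    hσp.mul (IsStronglyProgressive.continuous_comp hprog hΦ'c)
  have hgsq : ∀ t' : ℝ≥0, ∫⁻ ω, (∫⁻ s in Set.Icc (0 : ℝ) t', ENNReal.ofReal
      ((σ' s.toNNReal ω * deriv (ywFun p) (Z s.toNNReal ω)) ^ 2)) ∂preWienerMeasure ≠ ∞ := by
    intro t'
    refine ne_top_of_le_ne_top (hγsq t')
      (lintegral_mono fun ω ↦ lintegral_mono fun s ↦ ENNReal.ofReal_le_ofReal ?_)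
    rw [mul_pow]
    exact mul_le_of_le_one_right (sq_nonneg _) ((sq_le_one_iff_abs_le_one _).2 (hΦ'bd _))
  obtain ⟨Kp, hKp, hKpM, -⟩ := exists_isItoIntegral_of_sq_integrable hgp hgsq
  -- Itô's formula for `Φ(Z)`
  have hf2 : ContDiff ℝ 2 (Function.uncurry fun (_ : ℝ) ↦ ywFun p) := hΦc2.comp contDiff_snd
  have hito := ito_formula_itoProcess_ae_holds (fun (_ : ℝ) ↦ ywFun p) hf2 hZa hσp hX hKp
  -- the pathwise inequality at time `t`
  have hpath : ∀ᵐ ω ∂preWienerMeasure,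
      ywFun p (Z t ω) ≤ ywFun p z₀ + δ * (t : ℝ) +
        2⁻¹ * (∫ s in Set.Ioc (0 : ℝ) t, σ' s.toNNReal ω ^ 2 * p |Z s.toNNReal ω|) +
          Kp t ω := by
    filter_upwards [hito, hZc] with ω hI hcω
    have hZpc : Continuous fun r : ℝ ↦ Z r.toNNReal ω := hcω.comp continuous_real_toNNReal
    -- integrability on `(0, t]`
    haveI : IsFiniteMeasure (volume.restrict (Set.Ioc (0 : ℝ) t)) :=
      isFiniteMeasure_restrict.2 (by simp)
    have hI1 : IntegrableOn (fun s : ℝ ↦ deriv (ywFun p) (Z s.toNNReal ω)) (Set.Ioc 0 t) := by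
      refine Integrable.of_bound ?_ 1 (ae_of_all _ fun s ↦ ?_)
      · exact (hΦ'c.measurable.comp hZpc.measurable).aestronglyMeasurable
      · rw [Real.norm_eq_abs]
        exact hΦ'bd _
    have hI1δ : IntegrableOn (fun s : ℝ ↦ δ * deriv (ywFun p) (Z s.toNNReal ω)) (Set.Ioc 0 t) :=
      hI1.const_mul δ
    have hI3 : IntegrableOn (fun _ : ℝ ↦ (1 : ℝ)) (Set.Ioc 0 (t : ℝ)) :=
      integrableOn_const measure_Ioc_lt_top.ne
    have hI2T : IntegrableOn (fun s : ℝ ↦ σ' s.toNNReal ω ^ 2 * p |Z s.toNNReal ω|)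
        (Set.Ioc 0 t) := by
      have hc : Continuous fun s : ℝ ↦ σ' s.toNNReal ω ^ 2 * p |Z s.toNNReal ω| :=
        ((hσc.comp hZpc).pow 2).mul (hpc.comp (continuous_abs.comp hZpc))
      exact (hc.integrableOn_Icc (a := (0 : ℝ)) (b := (t : ℝ))).mono_set Set.Ioc_subset_Icc_self
    have hI2 : IntegrableOn (fun s : ℝ ↦ 2⁻¹ * (σ' s.toNNReal ω ^ 2 * p |Z s.toNNReal ω|))
        (Set.Ioc 0 t) := hI2T.const_mul _
    -- Itô's formula at time `t`, rewritten
    have hI' := hI t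
    simp only [deriv_const, zero_add, hZ0 ω, hΦ''] at hI'
    rw [hI', intervalIntegral.integral_of_le t.coe_nonneg]
    have hfun : (fun s : ℝ ↦ δ * deriv (ywFun p) (Z s.toNNReal ω) +
        2⁻¹ * σ' s.toNNReal ω ^ 2 * p |Z s.toNNReal ω|) =
        fun s : ℝ ↦ δ * deriv (ywFun p) (Z s.toNNReal ω) +
          2⁻¹ * (σ' s.toNNReal ω ^ 2 * p |Z s.toNNReal ω|) := by
      funext s; ring
    rw [hfun, integral_add hI1δ hI2, integral_const_mul, integral_const_mul]
    have h1 : ∫ s in Set.Ioc (0 : ℝ) t, deriv (ywFun p) (Z s.toNNReal ω) ≤ (t : ℝ) := by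
      have h := setIntegral_mono_on hI1 hI3 measurableSet_Ioc
        fun s _ ↦ (le_abs_self _).trans (hΦ'bd _)
      have h2 : ∫ _ in Set.Ioc (0 : ℝ) t, (1 : ℝ) = (t : ℝ) := by
        rw [setIntegral_const, Real.volume_real_Ioc_of_le t.coe_nonneg, sub_zero, smul_eq_mul,
          mul_one]
      linarith
    have h1' := mul_le_mul_of_nonneg_left h1 hδ
    linarith
  -- integrate the pathwise inequality
  have hΦint : Integrable (fun ω ↦ ywFun p (Z t ω)) preWienerMeasure :=
    Integrable.mono' (hZint t).abs
      ((continuous_ywFun hpc).measurable.comp (hZtm t)).aestronglyMeasurable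
      (ae_of_all _ fun ω ↦ by rw [Real.norm_eq_abs]; exact hΦabs _)
  have hG_int : Integrable (fun z : (ℝ≥0 → ℝ) × ℝ ↦
      σ' z.2.toNNReal z.1 ^ 2 * p |Z z.2.toNNReal z.1|) πT := by
    refine Integrable.mono' (hγ2_int.mul_const Cp)
      ((hσm.pow_const 2).mul (hpc.measurable.comp habsZ_m)).aestronglyMeasurable
      (ae_of_all _ fun z ↦ ?_)
    rw [norm_mul, Real.norm_eq_abs, abs_of_nonneg (sq_nonneg _)]
    exact mul_le_mul_of_nonneg_left (hCp _) (sq_nonneg _)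
  have hB_int : Integrable (fun ω ↦ ∫ s in Set.Ioc (0 : ℝ) t,
      σ' s.toNNReal ω ^ 2 * p |Z s.toNNReal ω|) preWienerMeasure :=
    (hπT ▸ hG_int).integral_prod_left
  have hKint : Integrable (Kp t) preWienerMeasure := hKpM.integrable t
  have hEK : ∫ ω, Kp t ω ∂preWienerMeasure = 0 := by
    have h := hKpM.setIntegral_eq (show (0 : ℝ≥0) ≤ t from bot_le)
      (MeasurableSet.univ (α := ℝ≥0 → ℝ))
    rw [setIntegral_univ, setIntegral_univ] at h
    rw [← h]
    simp [hKp.apply_zero]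
  have h12int : Integrable (fun ω ↦ ywFun p z₀ + δ * (t : ℝ) +
      2⁻¹ * (∫ s in Set.Ioc (0 : ℝ) t, σ' s.toNNReal ω ^ 2 * p |Z s.toNNReal ω|))
      preWienerMeasure :=
    (integrable_const _).add (hB_int.const_mul 2⁻¹)
  have hRHSint : Integrable (fun ω ↦ ywFun p z₀ + δ * (t : ℝ) +
      2⁻¹ * (∫ s in Set.Ioc (0 : ℝ) t, σ' s.toNNReal ω ^ 2 * p |Z s.toNNReal ω|) + Kp t ω)
      preWienerMeasure := h12int.add hKint
  have hE := integral_mono_ae hΦint hRHSint hpath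
  rw [integral_add h12int hKint, integral_add (integrable_const _) (hB_int.const_mul 2⁻¹),
    integral_const_mul, hEK, add_zero, integral_const, probReal_univ, one_smul] at hE
  -- the lower bound `E|Z_t| - η/2 ≤ E Φ(Z_t)`
  have hlow : ∫ ω, |Z t ω| ∂preWienerMeasure - η / 2 ≤ ∫ ω, ywFun p (Z t ω) ∂preWienerMeasure := by
    have h1 : ∫ ω, (|Z t ω| - η / 2) ∂preWienerMeasure ≤
        ∫ ω, ywFun p (Z t ω) ∂preWienerMeasure :=
      integral_mono ((hZint t).abs.sub (integrable_const _)) hΦint fun ω ↦ hΦlow _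
    rw [integral_sub (hZint t).abs (integrable_const _), integral_const, probReal_univ,
      one_smul] at h1
    exact h1
  -- the occupation bound `E ∫₀ᵗ σ'² p(|Z|) = ∫ p dν ≤ η`
  have hocc : ∫ ω, (∫ s in Set.Ioc (0 : ℝ) t, σ' s.toNNReal ω ^ 2 * p |Z s.toNNReal ω|)
      ∂preWienerMeasure ≤ η := by
    rw [← hoccup hpc ⟨Cp, hCp⟩]
    exact hpε
  -- `Φ(z₀) ≤ z₀`
  have hΦz₀ : ywFun p z₀ ≤ z₀ := (le_abs_self _).trans ((hΦabs z₀).trans (abs_of_nonneg hz₀).le)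
  linarith

/-- **`Z_t ≥ 0` a.s. at a fixed time** for a squared Bessel process `BESQ^δ(z₀)` with `δ ≥ 0`,
`z₀ ≥ 0`, driven by the canonical Brownian motion: `E|Z_t| ≤ z₀ + δ t = E Z_t`
(`integral_abs_le_of_isStronglyProgressive` for the progressive version `dyadicReg Z`, and
`integral_eq`), so `E Z_t⁻ = 0`.
Revuz–Yor, *Continuous Martingales and Brownian Motion* (1999), Ch. XI, §1, p. 439.
[cite: RevuzYor1999, Ch. XI §1 (p. 439) and Ch. IX Thm (3.7)] -/
theorem ae_nonneg_apply
    (hZ : IsSquaredBesselProcess δ z₀ Z brownian brownianFiltration preWienerMeasure)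
    (hδ : 0 ≤ δ) (hz₀ : 0 ≤ z₀) (t : ℝ≥0) : ∀ᵐ ω ∂preWienerMeasure, 0 ≤ Z t ω := by
  haveI := isProbabilityMeasure_preWienerMeasure'
  obtain ⟨hZ', hprog, hae⟩ := IsStrongSolution.dyadicReg_spec hZ
  have hZ'' : IsSquaredBesselProcess δ z₀ (dyadicReg Z) brownian brownianFiltration
      preWienerMeasure := hZ'
  have h1 := integral_abs_le_of_isStronglyProgressive hZ'' hprog hδ hz₀ t
  rw [← hZ''.integral_eq t] at h1
  have hint := hZ''.integrable t
  have h2 : ∫ ω, (|dyadicReg Z t ω| - dyadicReg Z t ω) ∂preWienerMeasure = 0 := by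
    refine le_antisymm ?_ (integral_nonneg fun ω ↦ sub_nonneg.2 (le_abs_self _))
    rw [integral_sub hint.abs hint]
    linarith
  have h3 := (integral_eq_zero_iff_of_nonneg (fun ω ↦ sub_nonneg.2 (le_abs_self _))
    (hint.abs.sub hint)).1 h2
  filter_upwards [h3, hae] with ω hω hωeq
  have h4 : |dyadicReg Z t ω| = dyadicReg Z t ω := sub_eq_zero.1 hω
  rw [← hωeq t, ← h4]
  exact abs_nonneg _

/-- **Squared Bessel processes of dimension `δ ≥ 0` started at `z₀ ≥ 0` are nonnegative**: for
a solution `Z` of `dZ = δ dt + 2√|Z| dB`, `Z₀ = z₀`, driven by the canonical Brownian motion and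
adapted to its raw filtration, almost surely `Z_t ≥ 0` for all `t` (nonnegativity at rational times,
`ae_nonneg_apply`, and continuity of the paths). Revuz–Yor obtain this from the comparison
theorem Ch. IX (3.7) (p. 439: "the solutions … for `δ ≥ 0`, `x ≥ 0` … are positive"); here it is
the canonical-space case of the named fact `IsSquaredBesselProcess.ae_forall_nonneg`.
Revuz–Yor, *Continuous Martingales and Brownian Motion* (1999), Ch. XI, §1, p. 439 and Ch. IX,
Thm (3.7). [cite: RevuzYor1999, Ch. XI §1 (p. 439) and Ch. IX Thm (3.7)] -/
theorem ae_nonneg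
    (hZ : IsSquaredBesselProcess δ z₀ Z brownian brownianFiltration preWienerMeasure)
    (hδ : 0 ≤ δ) (hz₀ : 0 ≤ z₀) : ∀ᵐ ω ∂preWienerMeasure, ∀ t, 0 ≤ Z t ω := by
  have hq : ∀ q : ℚ, ∀ᵐ ω ∂preWienerMeasure, 0 ≤ Z ((q : ℝ).toNNReal) ω := fun q ↦
    hZ.ae_nonneg_apply hδ hz₀ _
  filter_upwards [ae_all_iff.2 hq, IsStrongSolution.ae_continuous hZ] with ω hω hc t
  have hS : IsClosed {s : ℝ≥0 | 0 ≤ Z s ω} := isClosed_le continuous_const hc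
  have hsub : Set.range (fun q : ℚ ↦ ((q : ℝ).toNNReal)) ⊆ {s : ℝ≥0 | 0 ≤ Z s ω} := by
    rintro _ ⟨q, rfl⟩
    exact hω q
  have h := hS.closure_subset_iff.2 hsub
  rw [denseRange_toNNReal_ratCast.closure_range] at h
  exact h (Set.mem_univ t)

end IsSquaredBesselProcess

end Literature.Analysis.FunctionSpaces
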